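import Literature.AlgebraicGeometry.Motives.MixedHodgeStructureCatDualObjects
import Literature.AlgebraicGeometry.Motives.MixedHodgeStructureCatGradedPolarizable
import Mathlib.CategoryTheory.ObjectProperty.ClosedUnderIsomorphisms
import Mathlib.CategoryTheory.Preadditive.Opposite
import HarnessLib

/-!
# The duality functor `X ↦ X^∨` on finite-dimensional mixed Hodge structures: an involutive anti-equivalence

Layer `Literature/AlgebraicGeometry/Motives` (lane `lit-hodgefound`).  The tree's unbundled duality (`Motives/MixedHodgeStructureDual`: `H.dual`,
`f.transpose`; `Motives/MixedHodgeStructureBidual`: the biduality morphism `Hom.bidual H : H → H^∨∨`, bijective, natural —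
`transpose_transpose_comp_bidual`) is assembled here into a FUNCTOR.  Since `H.dual` needs `V` finite-dimensional, the functor lives on the full
subcategory `FinSubcategory := isFinite.FullSubcategory` of finite-dimensional objects of `MixedHodgeStructureCat` (every graded-polarizable object,
every object met in geometry, is there):

* §1 the object property `isFinite` (closed under isomorphisms, subobjects, quotients, duals; contains `isGradedPolarizable`) and `FinSubcategory`;
* §2 biduality in the ambient category: `bidualHom X : X ⟶ X^∨∨`, its inverse `bidualInvHom`, the isomorphism **`bidualIso X : X ≅ X^∨∨`**, naturality
  (`bidualHom_naturality`, `bidualInvHom_naturality`), and the consequences for transposition on hom-sets: `transposeHom_injective`,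
  **`transposeHom_surjective`** (every `g : Y^∨ ⟶ X^∨` is `f^∨` for `f = i_Y⁻¹ ∘ g^∨ ∘ i_X`), the bijection **`transposeEquiv : (X ⟶ Y) ≃ (Y^∨ ⟶ X^∨)`**;
* §3 **`dualFunctor : FinSubcategoryᵒᵖ ⥤ FinSubcategory`** (`X ↦ X^∨`, `f ↦ f^∨`), additive, with the natural isomorphism
  **`bidualNatIso : 𝟭 ≅ dualFunctor.rightOp ⋙ dualFunctor`** and the adjoint equivalence **`dualEquivalence : FinSubcategoryᵒᵖ ≌ FinSubcategory`**
  (unit and counit from `bidualIso`); hence `dualFunctor` is an equivalence — full, faithful, essentially surjective.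

Everything is PROVED; no named fact, no instance (class-valued statements such as `dualFunctor.Additive`, `dualFunctor.IsEquivalence` are theorems),
no notation.

Sources, verbatim (through the tree's files).  A. Fujiki, *Duality of mixed Hodge structures of algebraic varieties*, Publ. RIMS 16 (1980) [Fujiki1980],
(1.6.2) a): the dual filtrations define an MHS `V^*` and «the natural isomorphism `V ≅ V^{**}` of vector spaces is an isomorphism of MHS».  E. Cattani,
F. El Zein, P. A. Griffiths, Lê D. T. (eds.), *Hodge Theory* (2014) [CattaniElZeinGriffithsLe2014], §3.2.2.7 (dual MHS, transposes) and Thm. 3.2.18 (the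
category of MHS is abelian).  P. Deligne, *Théorie de Hodge II* (1971) [DeligneHodgeII1971], 1.1.6–1.1.7 (dual filtrations), 2.3.5.  The categorical
framework (full subcategories, `Equivalence.mk`, `Functor.IsEquivalence`) is Mathlib's [folklore].

## Main results

* §1 `isFinite`, `isFinite_iff`, `isFinite_of_iso`, `isFinite_isClosedUnderIsomorphisms`, `isFinite_of_mono`, `isFinite_of_epi`, `isFinite_dual`,
  `isGradedPolarizable_le_isFinite`, `FinSubcategory`, `toFinSubcategory`.
* §2 `bidualHom`, `bidualInvHom`, `bidualHom_toLinearMap`, `bidualHom_comp_bidualInvHom`, `bidualInvHom_comp_bidualHom`, **`bidualIso`**, `isIso_bidualHom`,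
  **`bidualHom_naturality`**, `bidualInvHom_naturality`, `apply_bidualInvHom`, `transposeHom_injective`, `transposeHom_bidual_conj`, `bidual_conj_transposeHom`,
  **`transposeHom_surjective`**, `transposeHom_bijective`, **`transposeEquiv`** (`_apply`, `_symm_apply`), `transposeHom_neg`, `transposeHom_sub`.
* §3 `dualObj`, `dualMap` (`_hom`, `_id`, `_comp`, `_add`), **`dualFunctor`** (`_obj`, `_map`), `dualFunctor_additive`, `bidualIsoFin` (`_hom_hom`, `_inv_hom`),
  `bidualIsoFin_hom_naturality`, `bidualIsoFin_inv_naturality`, **`bidualNatIso`**, **`dualEquivalence`** (`_functor`, `_inverse`, `_counitIso`),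
  **`dualFunctor_isEquivalence`**, `dualFunctor_faithful`, `dualFunctor_full`, `dualFunctor_essSurj`, `dualFunctor_rightOp_isEquivalence`.

## References

* [Fujiki1980] A. Fujiki, Duality of mixed Hodge structures of algebraic varieties, Publ. RIMS Kyoto Univ. 16 (1980), (1.6.2) a).
* [CattaniElZeinGriffithsLe2014] E. Cattani et al. (eds.), Hodge Theory, Princeton Math. Notes 49 (2014), §3.2.2.7, Thm. 3.2.18.
* [DeligneHodgeII1971] P. Deligne, Théorie de Hodge II, Publ. Math. IHÉS 40 (1971), 1.1.6–1.1.7, 2.3.5.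

## Provenance

Lane `lit-hodgefound` (summit `HodgeConjecture`), seat `lit-hodgefound-p36` (literature-prover, generation 45, row g45-#10).
-/

noncomputable section

open CategoryTheory CategoryTheory.Limits Opposite

namespace Literature.AlgebraicGeometry.Motives

universe u

namespace MixedHodgeStructureCat

/-! ## §1 The full subcategory of finite-dimensional mixed Hodge structures -/

section Finite

/-- The property «the underlying `ℚ`-vector space is finite-dimensional» of an object of `MixedHodgeStructureCat`. [cite: Fujiki1980, (1.6.2) a)] -/
def isFinite : ObjectProperty MixedHodgeStructureCat.{u} := fun X => Module.Finite ℚ X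

/-- Unfolding `isFinite`. [cite: Fujiki1980, (1.6.2) a)] -/
theorem isFinite_iff (X : MixedHodgeStructureCat.{u}) : isFinite X ↔ Module.Finite ℚ X := Iff.rfl

/-- `isFinite` is invariant under isomorphism (an isomorphism of MHS is a linear isomorphism). [cite: CattaniElZeinGriffithsLe2014, Thm. 3.2.18] -/
theorem isFinite_of_iso {X Y : MixedHodgeStructureCat.{u}} (e : X ≅ Y) (hX : isFinite X) : isFinite Y :=
  haveI : Module.Finite ℚ X := hX
  Module.Finite.of_surjective e.hom.toLinearMap ((isIso_iff_bijective e.hom).1 inferInstance).2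

/-- `isFinite` is closed under isomorphisms. [cite: CattaniElZeinGriffithsLe2014, Thm. 3.2.18] -/
theorem isFinite_isClosedUnderIsomorphisms : isFinite.{u}.IsClosedUnderIsomorphisms :=
  ⟨fun e hX => isFinite_of_iso e hX⟩

/-- A subobject of a finite-dimensional object is finite-dimensional (monomorphisms of MHS are injective). [cite: CattaniElZeinGriffithsLe2014, Thm. 3.2.18] -/
theorem isFinite_of_mono {X Y : MixedHodgeStructureCat.{u}} (f : X ⟶ Y) [Mono f] (hY : isFinite Y) : isFinite X :=
  haveI : Module.Finite ℚ Y := hY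
  FiniteDimensional.of_injective f.toLinearMap ((mono_iff_injective f).1 inferInstance)

/-- A quotient of a finite-dimensional object is finite-dimensional (epimorphisms of MHS are surjective). [cite: CattaniElZeinGriffithsLe2014, Thm. 3.2.18] -/
theorem isFinite_of_epi {X Y : MixedHodgeStructureCat.{u}} (f : X ⟶ Y) [Epi f] (hX : isFinite X) : isFinite Y :=
  haveI : Module.Finite ℚ X := hX
  Module.Finite.of_surjective f.toLinearMap ((epi_iff_surjective f).1 inferInstance)

/-- The dual of a finite-dimensional object is finite-dimensional. [cite: Fujiki1980, (1.6.2) a)] -/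
theorem isFinite_dual (X : MixedHodgeStructureCat.{u}) [Module.Finite ℚ X] : isFinite (of X.str.dual) :=
  finite_dual X

/-- Graded-polarizable objects (the tree's `isGradedPolarizable`, finite-dimensional by definition) are in `isFinite`. [cite: Fujiki1980, (1.6.2) a)] -/
theorem isGradedPolarizable_le_isFinite : isGradedPolarizable.{u} ≤ isFinite.{u} := fun _ h => h.finite

/-- **The full subcategory of finite-dimensional mixed Hodge structures.** [cite: Fujiki1980, (1.6.2) a)] [cite: CattaniElZeinGriffithsLe2014, Thm. 3.2.18] -/
abbrev FinSubcategory : Type (u + 1) := isFinite.{u}.FullSubcategory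

/-- A finite-dimensional object as an object of `FinSubcategory`. [cite: Fujiki1980, (1.6.2) a)] -/
abbrev toFinSubcategory (X : MixedHodgeStructureCat.{u}) [Module.Finite ℚ X] : FinSubcategory.{u} := ⟨X, ‹Module.Finite ℚ X›⟩

end Finite

/-! ## §2 Biduality in the ambient category and transposition on hom-sets -/

section Bidual

variable {X Y : MixedHodgeStructureCat.{u}} [Module.Finite ℚ X] [Module.Finite ℚ Y]

variable (X) in
/-- **The biduality morphism `i_X : X ⟶ X^∨∨`**, `v ↦ (φ ↦ φ v)` (the tree's `Hom.bidual`). [cite: Fujiki1980, (1.6.2) a)] -/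
abbrev bidualHom : X ⟶ of X.str.dual.dual := MixedHodgeStructure.Hom.bidual X.str

variable (X) in
/-- The inverse `i_X⁻¹ : X^∨∨ ⟶ X` (the tree's `Hom.bidualInv`). [cite: Fujiki1980, (1.6.2) a)] -/
abbrev bidualInvHom : of X.str.dual.dual ⟶ X := MixedHodgeStructure.Hom.bidualInv X.str

variable (X) in
/-- On vectors `i_X` is `Module.Dual.eval`. [cite: Fujiki1980, (1.6.2) a)] -/
theorem bidualHom_toLinearMap : (bidualHom X).toLinearMap = Module.Dual.eval ℚ X := rfl

variable (X) in
/-- `i_X ≫ i_X⁻¹ = 𝟙`. [cite: Fujiki1980, (1.6.2) a)] -/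
theorem bidualHom_comp_bidualInvHom : bidualHom X ≫ bidualInvHom X = 𝟙 X :=
  MixedHodgeStructure.Hom.bidualInv_comp_bidual X.str

variable (X) in
/-- `i_X⁻¹ ≫ i_X = 𝟙`. [cite: Fujiki1980, (1.6.2) a)] -/
theorem bidualInvHom_comp_bidualHom : bidualInvHom X ≫ bidualHom X = 𝟙 (of X.str.dual.dual) :=
  MixedHodgeStructure.Hom.bidual_comp_bidualInv X.str

variable (X) in
/-- **`X ≅ X^∨∨`** in `MixedHodgeStructureCat` («the natural isomorphism `V ≅ V^{**}` is an isomorphism of MHS»). [cite: Fujiki1980, (1.6.2) a)] -/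
def bidualIso : X ≅ of X.str.dual.dual where
  hom := bidualHom X
  inv := bidualInvHom X
  hom_inv_id := bidualHom_comp_bidualInvHom X
  inv_hom_id := bidualInvHom_comp_bidualHom X

variable (X) in
/-- `i_X` is an isomorphism. [cite: Fujiki1980, (1.6.2) a)] -/
theorem isIso_bidualHom : IsIso (bidualHom X) := (bidualIso X).isIso_hom

/-- **Naturality of biduality**: `f ≫ i_Y = i_X ≫ f^∨∨`. [cite: Fujiki1980, (1.6.2) a)] -/
theorem bidualHom_naturality (f : X ⟶ Y) : f ≫ bidualHom Y = bidualHom X ≫ transposeHom (transposeHom f) :=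
  (MixedHodgeStructure.Hom.transpose_transpose_comp_bidual f).symm

/-- Naturality of the inverse: `f^∨∨ ≫ i_Y⁻¹ = i_X⁻¹ ≫ f`. [cite: Fujiki1980, (1.6.2) a)] -/
theorem bidualInvHom_naturality (f : X ⟶ Y) : transposeHom (transposeHom f) ≫ bidualInvHom Y = bidualInvHom X ≫ f := by
  haveI : IsIso (bidualHom X) := isIso_bidualHom X
  rw [← cancel_epi (bidualHom X), ← Category.assoc, ← bidualHom_naturality f, Category.assoc, bidualHom_comp_bidualInvHom,
    Category.comp_id, ← Category.assoc, bidualHom_comp_bidualInvHom, Category.id_comp]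

variable (X) in
/-- `ψ (i_X⁻¹ Φ) = Φ ψ`: the vector `i_X⁻¹ Φ` evaluates functionals as `Φ` does. [cite: Fujiki1980, (1.6.2) a)] -/
theorem apply_bidualInvHom (Φ : Module.Dual ℚ (Module.Dual ℚ X)) (ψ : Module.Dual ℚ X) : ψ ((bidualInvHom X).toLinearMap Φ) = Φ ψ := by
  have h := congrArg (fun e : of X.str.dual.dual ⟶ of X.str.dual.dual => e.toLinearMap Φ ψ) (bidualInvHom_comp_bidualHom X)
  exact h

/-- **Transposition is injective on hom-sets**: `f^∨ = g^∨ ⟹ f = g`. [cite: Fujiki1980, (1.6.2) a)] [cite: CattaniElZeinGriffithsLe2014, §3.2.2.7] -/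
theorem transposeHom_injective : Function.Injective (fun f : X ⟶ Y => transposeHom f) := by
  intro f g h
  have h' : transposeHom f = transposeHom g := h
  haveI : IsIso (bidualHom Y) := isIso_bidualHom Y
  rw [← cancel_mono (bidualHom Y), bidualHom_naturality, bidualHom_naturality, h']

/-- The transpose of `i_X ≫ g^∨ ≫ i_Y⁻¹` is `g` (`g : Y^∨ ⟶ X^∨`). [cite: Fujiki1980, (1.6.2) a)] [cite: CattaniElZeinGriffithsLe2014, §3.2.2.7] -/
theorem transposeHom_bidual_conj (g : of Y.str.dual ⟶ of X.str.dual) : transposeHom (bidualHom X ≫ transposeHom g ≫ bidualInvHom Y) = g := by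
  apply hom_ext
  refine LinearMap.ext fun ψ => LinearMap.ext fun x => ?_
  rw [transposeHom_toLinearMap, LinearMap.dualMap_apply, comp_toLinearMap, comp_toLinearMap, LinearMap.comp_apply, LinearMap.comp_apply,
    apply_bidualInvHom, transposeHom_toLinearMap, LinearMap.dualMap_apply]
  rfl

/-- `i_X ≫ f^∨∨ ≫ i_Y⁻¹ = f`. [cite: Fujiki1980, (1.6.2) a)] -/
theorem bidual_conj_transposeHom (f : X ⟶ Y) : bidualHom X ≫ transposeHom (transposeHom f) ≫ bidualInvHom Y = f := by
  rw [bidualInvHom_naturality, ← Category.assoc, bidualHom_comp_bidualInvHom, Category.id_comp]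

/-- **Transposition is surjective on hom-sets**: every morphism `Y^∨ ⟶ X^∨` is a transpose. [cite: Fujiki1980, (1.6.2) a)]
[cite: CattaniElZeinGriffithsLe2014, §3.2.2.7] -/
theorem transposeHom_surjective : Function.Surjective (fun f : X ⟶ Y => transposeHom f) :=
  fun g => ⟨bidualHom X ≫ transposeHom g ≫ bidualInvHom Y, transposeHom_bidual_conj g⟩

/-- Transposition `(X ⟶ Y) → (Y^∨ ⟶ X^∨)` is bijective. [cite: Fujiki1980, (1.6.2) a)] [cite: CattaniElZeinGriffithsLe2014, §3.2.2.7] -/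
theorem transposeHom_bijective : Function.Bijective (fun f : X ⟶ Y => transposeHom f) :=
  ⟨transposeHom_injective, transposeHom_surjective⟩

variable (X Y) in
/-- **`Hom(X, Y) ≃ Hom(Y^∨, X^∨)`**, `f ↦ f^∨`, with inverse `g ↦ i_X ≫ g^∨ ≫ i_Y⁻¹`. [cite: Fujiki1980, (1.6.2) a)] [cite: CattaniElZeinGriffithsLe2014, §3.2.2.7] -/
def transposeEquiv : (X ⟶ Y) ≃ (of Y.str.dual ⟶ of X.str.dual) where
  toFun f := transposeHom f
  invFun g := bidualHom X ≫ transposeHom g ≫ bidualInvHom Y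
  left_inv f := bidual_conj_transposeHom f
  right_inv g := transposeHom_bidual_conj g

/-- Unfolding `transposeEquiv`. [cite: Fujiki1980, (1.6.2) a)] -/
theorem transposeEquiv_apply (f : X ⟶ Y) : transposeEquiv X Y f = transposeHom f := rfl

/-- Unfolding `transposeEquiv.symm`. [cite: Fujiki1980, (1.6.2) a)] -/
theorem transposeEquiv_symm_apply (g : of Y.str.dual ⟶ of X.str.dual) :
    (transposeEquiv X Y).symm g = bidualHom X ≫ transposeHom g ≫ bidualInvHom Y := rfl

/-- `(-f)^∨ = -f^∨`. [cite: CattaniElZeinGriffithsLe2014, §3.2.2.7] -/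
theorem transposeHom_neg (f : X ⟶ Y) : transposeHom (-f) = -transposeHom f := by
  rw [eq_neg_iff_add_eq_zero, ← transposeHom_add, neg_add_cancel, transposeHom_zero]

/-- `(f - g)^∨ = f^∨ - g^∨`. [cite: CattaniElZeinGriffithsLe2014, §3.2.2.7] -/
theorem transposeHom_sub (f g : X ⟶ Y) : transposeHom (f - g) = transposeHom f - transposeHom g := by
  rw [sub_eq_add_neg, transposeHom_add, transposeHom_neg, ← sub_eq_add_neg]

end Bidual

/-! ## §3 The duality functor and the anti-equivalence -/

section DualFunctor

/-- The dual `X^∨` of an object of `FinSubcategory`. [cite: Fujiki1980, (1.6.2) a)] -/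
def dualObj (X : FinSubcategory.{u}) : FinSubcategory.{u} :=
  haveI : Module.Finite ℚ X.obj := X.property
  ⟨of X.obj.str.dual, finite_dual X.obj⟩

/-- Unfolding `dualObj`. [cite: Fujiki1980, (1.6.2) a)] -/
theorem dualObj_obj (X : FinSubcategory.{u}) :
    (dualObj X).obj = haveI : Module.Finite ℚ X.obj := X.property; of X.obj.str.dual := rfl

/-- The transpose `f^∨ : Y^∨ ⟶ X^∨` of a morphism of `FinSubcategory`. [cite: Fujiki1980, (1.6.2) a)] [cite: CattaniElZeinGriffithsLe2014, §3.2.2.7] -/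
def dualMap {X Y : FinSubcategory.{u}} (f : X ⟶ Y) : dualObj Y ⟶ dualObj X :=
  haveI : Module.Finite ℚ X.obj := X.property
  haveI : Module.Finite ℚ Y.obj := Y.property
  ObjectProperty.homMk (transposeHom f.hom)

/-- Unfolding `dualMap`. [cite: Fujiki1980, (1.6.2) a)] -/
theorem dualMap_hom {X Y : FinSubcategory.{u}} (f : X ⟶ Y) :
    (dualMap f).hom = haveI : Module.Finite ℚ X.obj := X.property; haveI : Module.Finite ℚ Y.obj := Y.property; transposeHom f.hom := rfl

/-- `(𝟙 X)^∨ = 𝟙 X^∨`. [cite: CattaniElZeinGriffithsLe2014, §3.2.2.7] -/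
theorem dualMap_id (X : FinSubcategory.{u}) : dualMap (𝟙 X) = 𝟙 (dualObj X) := by
  apply ObjectProperty.hom_ext
  haveI : Module.Finite ℚ X.obj := X.property
  exact transposeHom_id X.obj

/-- `(f ≫ g)^∨ = g^∨ ≫ f^∨`. [cite: CattaniElZeinGriffithsLe2014, §3.2.2.7] -/
theorem dualMap_comp {X Y Z : FinSubcategory.{u}} (f : X ⟶ Y) (g : Y ⟶ Z) : dualMap (f ≫ g) = dualMap g ≫ dualMap f := by
  apply ObjectProperty.hom_ext
  haveI : Module.Finite ℚ X.obj := X.property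
  haveI : Module.Finite ℚ Y.obj := Y.property
  haveI : Module.Finite ℚ Z.obj := Z.property
  exact transposeHom_comp f.hom g.hom

/-- `(f + g)^∨ = f^∨ + g^∨`. [cite: CattaniElZeinGriffithsLe2014, §3.2.2.7] -/
theorem dualMap_add {X Y : FinSubcategory.{u}} (f g : X ⟶ Y) : dualMap (f + g) = dualMap f + dualMap g := by
  apply ObjectProperty.hom_ext
  haveI : Module.Finite ℚ X.obj := X.property
  haveI : Module.Finite ℚ Y.obj := Y.property
  exact transposeHom_add f.hom g.hom

/-- **The duality functor `X ↦ X^∨`, `f ↦ f^∨`** on finite-dimensional mixed Hodge structures (contravariant: from the opposite category).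
[cite: Fujiki1980, (1.6.2) a)] [cite: CattaniElZeinGriffithsLe2014, §3.2.2.7] -/
def dualFunctor : FinSubcategory.{u}ᵒᵖ ⥤ FinSubcategory.{u} where
  obj X := dualObj X.unop
  map f := dualMap f.unop
  map_id X := dualMap_id X.unop
  map_comp f g := dualMap_comp g.unop f.unop

/-- Unfolding `dualFunctor` on objects. [cite: Fujiki1980, (1.6.2) a)] -/
theorem dualFunctor_obj (X : FinSubcategory.{u}ᵒᵖ) : dualFunctor.obj X = dualObj X.unop := rfl

/-- Unfolding `dualFunctor` on morphisms. [cite: Fujiki1980, (1.6.2) a)] -/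
theorem dualFunctor_map {X Y : FinSubcategory.{u}ᵒᵖ} (f : X ⟶ Y) : dualFunctor.map f = dualMap f.unop := rfl

/-- **The duality functor is additive.** [cite: CattaniElZeinGriffithsLe2014, §3.2.2.7 and Thm. 3.2.18] -/
theorem dualFunctor_additive : dualFunctor.{u}.Additive :=
  ⟨fun {_ _ f g} => dualMap_add f.unop g.unop⟩

/-- `X ≅ X^∨∨` in `FinSubcategory`. [cite: Fujiki1980, (1.6.2) a)] -/
def bidualIsoFin (X : FinSubcategory.{u}) : X ≅ dualObj (dualObj X) :=
  haveI : Module.Finite ℚ X.obj := X.property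
  isFinite.isoMk (bidualIso X.obj)

/-- Unfolding `bidualIsoFin` (hom). [cite: Fujiki1980, (1.6.2) a)] -/
theorem bidualIsoFin_hom_hom (X : FinSubcategory.{u}) :
    (bidualIsoFin X).hom.hom = haveI : Module.Finite ℚ X.obj := X.property; bidualHom X.obj := rfl

/-- Unfolding `bidualIsoFin` (inv). [cite: Fujiki1980, (1.6.2) a)] -/
theorem bidualIsoFin_inv_hom (X : FinSubcategory.{u}) :
    (bidualIsoFin X).inv.hom = haveI : Module.Finite ℚ X.obj := X.property; bidualInvHom X.obj := rfl

/-- Naturality of `bidualIsoFin` (hom): `f ≫ i_Y = i_X ≫ f^∨∨`. [cite: Fujiki1980, (1.6.2) a)] -/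
theorem bidualIsoFin_hom_naturality {X Y : FinSubcategory.{u}} (f : X ⟶ Y) :
    f ≫ (bidualIsoFin Y).hom = (bidualIsoFin X).hom ≫ dualMap (dualMap f) := by
  apply ObjectProperty.hom_ext
  haveI : Module.Finite ℚ X.obj := X.property
  haveI : Module.Finite ℚ Y.obj := Y.property
  exact bidualHom_naturality f.hom

/-- Naturality of `bidualIsoFin` (inv): `f^∨∨ ≫ i_Y⁻¹ = i_X⁻¹ ≫ f`. [cite: Fujiki1980, (1.6.2) a)] -/
theorem bidualIsoFin_inv_naturality {X Y : FinSubcategory.{u}} (f : X ⟶ Y) :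
    dualMap (dualMap f) ≫ (bidualIsoFin Y).inv = (bidualIsoFin X).inv ≫ f := by
  apply ObjectProperty.hom_ext
  haveI : Module.Finite ℚ X.obj := X.property
  haveI : Module.Finite ℚ Y.obj := Y.property
  exact bidualInvHom_naturality f.hom

/-- **The biduality natural isomorphism `𝟭 ≅ (−)^∨∨`** on `FinSubcategory`. [cite: Fujiki1980, (1.6.2) a)] -/
def bidualNatIso : 𝟭 FinSubcategory.{u} ≅ dualFunctor.{u}.rightOp ⋙ dualFunctor.{u} :=
  NatIso.ofComponents (fun X => bidualIsoFin X) (fun f => bidualIsoFin_hom_naturality f)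

/-- **Duality is an anti-equivalence: `FinSubcategoryᵒᵖ ≌ FinSubcategory`**, functor `dualFunctor`, inverse `dualFunctor.rightOp`, unit and counit from
`X ≅ X^∨∨` (Mathlib's `Equivalence.mk` adjointifies the unit). [cite: Fujiki1980, (1.6.2) a)] [cite: CattaniElZeinGriffithsLe2014, §3.2.2.7] -/
def dualEquivalence : FinSubcategory.{u}ᵒᵖ ≌ FinSubcategory.{u} :=
  CategoryTheory.Equivalence.mk dualFunctor dualFunctor.rightOp
    (NatIso.ofComponents (fun X => (bidualIsoFin X.unop).symm.op) (fun {X Y} f => Quiver.Hom.unop_inj (by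
      change (bidualIsoFin Y.unop).inv ≫ f.unop = dualMap (dualMap f.unop) ≫ (bidualIsoFin X.unop).inv
      exact (bidualIsoFin_inv_naturality f.unop).symm)))
    bidualNatIso.symm

/-- The functor of `dualEquivalence` is `dualFunctor`. [cite: Fujiki1980, (1.6.2) a)] -/
theorem dualEquivalence_functor : dualEquivalence.{u}.functor = dualFunctor := rfl

/-- The inverse of `dualEquivalence` is `dualFunctor.rightOp`. [cite: Fujiki1980, (1.6.2) a)] -/
theorem dualEquivalence_inverse : dualEquivalence.{u}.inverse = dualFunctor.rightOp := rfl

/-- The counit of `dualEquivalence` is `bidualNatIso.symm`. [cite: Fujiki1980, (1.6.2) a)] -/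
theorem dualEquivalence_counitIso : dualEquivalence.{u}.counitIso = bidualNatIso.symm := rfl

/-- **`dualFunctor` is an equivalence of categories.** [cite: Fujiki1980, (1.6.2) a)] [cite: CattaniElZeinGriffithsLe2014, §3.2.2.7] -/
theorem dualFunctor_isEquivalence : dualFunctor.{u}.IsEquivalence := dualEquivalence.isEquivalence_functor

/-- `dualFunctor.rightOp : FinSubcategory ⥤ FinSubcategoryᵒᵖ` is an equivalence. [cite: Fujiki1980, (1.6.2) a)] -/
theorem dualFunctor_rightOp_isEquivalence : dualFunctor.{u}.rightOp.IsEquivalence := dualEquivalence.isEquivalence_inverse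

/-- `dualFunctor` is faithful. [cite: CattaniElZeinGriffithsLe2014, §3.2.2.7] -/
theorem dualFunctor_faithful : dualFunctor.{u}.Faithful :=
  haveI := dualFunctor_isEquivalence.{u}
  inferInstance

/-- `dualFunctor` is full. [cite: CattaniElZeinGriffithsLe2014, §3.2.2.7] -/
theorem dualFunctor_full : dualFunctor.{u}.Full :=
  haveI := dualFunctor_isEquivalence.{u}
  inferInstance

/-- `dualFunctor` is essentially surjective: `Y ≅ (Y^∨)^∨`. [cite: Fujiki1980, (1.6.2) a)] -/
theorem dualFunctor_essSurj : dualFunctor.{u}.EssSurj :=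
  ⟨fun Y => ⟨op (dualObj Y), ⟨(bidualIsoFin Y).symm⟩⟩⟩

end DualFunctor

end MixedHodgeStructureCat

end Literature.AlgebraicGeometry.Motives
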